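import Summits.AtomisticToContinuum.FouriersLaw.Theorems.HonestZwanzigRobinCoercivitySymbolZeroOfPositiveMemory

/-!
# `HonestZwanzig.RobinCoercivity`, line `limit-operator-memory-form`: rows of the block memory matrix against the
flux direction, and the contact rows (auxiliary to the link theorem `orthogonalOhm_of_blockInputs`)

Support file for the crux `stmt-AtomisticToContinuum-12695` (`RobinCoercivity` of route `HonestZwanzig`, sub-problem
`FouriersLaw`), line `limit-operator-memory-form`; auxiliary to the registered LINK theorem
`orthogonalOhm_of_blockInputs` (`…OhmOfBlockInputs`): (U′) `BlockBandDomination` ∧ (L) `BlockBulkLimit` ∧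
`FluxRowBound` ⇒ the route's rank-2 crux `OrthogonalOhm` as typed.

Positions `i : Fin (N+1)` (`0` = left contact, `1 … N−1` = bonds `b = i − 1`, `N` = right contact) carry the
observables `g_i` (bond current `j_{i−1}` at a bond, `γ(T − p_c²)` at a contact, `c = 0` resp. `N−1`); the block
memory matrix is `W_N(s)_{ij} = γT²[i = j contact] − schur_s(g_i∘Θ, g_j)`. This file provides

* pure bookkeeping on `Fin (N+1)` (`ohm2_bond_indicator_sum`, `ohm2_usplit` = the split
  `Σ_j W_{ij}u_j = Σ_{bond j} W_{ij} + W_{i0} − W_{iN}` against the flux direction `u = (1,…,1,−1)`,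
  `ohm2_two_offdiag_le`, and the two row bounds `ohm2_bond_row_abs_le` (registered sub-goal of this file) /
  `ohm2_contact_row_abs_le`: `|Σ_{bond j} W_{ij}| ≤ C_F + τ(0)` for a bond row from the flux-row bound and the
  off-diagonal tail, `|Σ_{bond j} W_{ij}| ≤ τ(0)` for a contact row);
* over the abstract gadgets of the fixed-`N` package (as in `…SymbolZeroOfPositiveMemory`): the affine rule
  `schur_s(a·f + c, h) = a·schur_s(f, h)` (`ohm2_schur_affine_left`), the reversed contact observable
  `g_i∘Θ = −γ·p_c² + γT` (`ohm2_contact_g_rev`), `Σ_{bond j} g_j = J` (`ohm2_bondCols_g_sum`), and the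
  **contact-row identity** `Σ_{bond j} W_N(s)_{ij} = γ·schur_s(p_c², J)` (`ohm2_contact_row_sum_pkg`, the headline
  of this file).
-/

noncomputable section

open MeasureTheory Finset Matrix Filter Topology
open Literature.MathematicalPhysics.KineticTheory.HeatConduction
open Summit.AtomisticToContinuum.FouriersLaw.Theses.HonestZwanzig
open Summit.AtomisticToContinuum.FouriersLaw.Theorems.HonestZwanzig.NetworkReduction
open Summit.AtomisticToContinuum.FouriersLaw.Theorems.RobinCoercivity.Negative

namespace Summit.AtomisticToContinuum.FouriersLaw.Theorems.HonestZwanzig.Robin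

/-! ### Pure bookkeeping on the positions `Fin (N+1)` -/

/-- The two spellings of the bond-column indicator on `Fin (N+1)` agree:
`1 ≤ j ∧ j + 1 ≤ N` iff `j ≠ 0 ∧ j ≠ N`. -/
theorem ohm2_bond_indicator_sum {N : ℕ} (w : Fin (N + 1) → ℝ) :
    (∑ j : Fin (N + 1), if 1 ≤ j.val ∧ j.val + 1 ≤ N then w j else 0) =
      ∑ j : Fin (N + 1), if j.val ≠ 0 ∧ j.val ≠ N then w j else 0 := by
  refine Finset.sum_congr rfl fun j _ => ?_
  have hj := j.isLt
  by_cases h : j.val ≠ 0 ∧ j.val ≠ N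
  · rw [if_pos h, if_pos (by omega)]
  · rw [if_neg h, if_neg (by omega)]

/-- **The `u`-split of a row.** Against the flux direction `u = (1, …, 1, −1)` (`u_N = −1`), a row `w` on the
positions `Fin (N+1)` pairs to `Σ_j w_j u_j = Σ_{bond j} w_j + w_0 − w_N`. -/
theorem ohm2_usplit {N : ℕ} (hN : 1 ≤ N) (w : Fin (N + 1) → ℝ) :
    ∑ j : Fin (N + 1), w j * (if j.val = N then -1 else 1) =
      (∑ j : Fin (N + 1), if j.val ≠ 0 ∧ j.val ≠ N then w j else 0) + w 0 - w (Fin.last N) := by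
  have hterm : ∀ j : Fin (N + 1), w j * (if j.val = N then -1 else 1) =
      (if j.val ≠ 0 ∧ j.val ≠ N then w j else 0) + (if j.val = 0 then w j else 0) -
        (if j.val = N then w j else 0) := by
    intro j
    by_cases h0 : j.val = 0
    · have hjN : j.val ≠ N := by omega
      rw [if_neg hjN, if_neg (fun h => h.1 h0), if_pos h0, if_neg hjN]
      ring
    · by_cases hjN : j.val = N
      · rw [if_pos hjN, if_neg (fun h => h.2 hjN), if_neg h0, if_pos hjN]
        ring
      · rw [if_neg hjN, if_pos ⟨h0, hjN⟩, if_neg h0, if_neg hjN]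
        ring
  have h0 : (∑ j : Fin (N + 1), if j.val = 0 then w j else 0) = w 0 :=
    sum_ite_eq_of_unique w 0 (Fin.val_zero (N + 1)) (fun j hj => Fin.ext (by rw [hj, Fin.val_zero]))
  have hL : (∑ j : Fin (N + 1), if j.val = N then w j else 0) = w (Fin.last N) :=
    sum_ite_eq_of_unique w (Fin.last N) (Fin.val_last N) (fun j hj => Fin.ext (by rw [hj, Fin.val_last]))
  rw [Finset.sum_congr rfl fun j _ => hterm j, Finset.sum_sub_distrib, Finset.sum_add_distrib, h0, hL]

/-- For a bond row `i` (`i ≠ 0, N`) the two contact entries `w_0, w_N` are OFF-diagonal, so they are absorbed by the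
`d = 0` band tail `Σ_{j : 0 < |i − j|} |w_j|`. -/
theorem ohm2_two_offdiag_le {N : ℕ} (hN : 1 ≤ N) (i : Fin (N + 1)) (hi0 : i.val ≠ 0) (hiN : i.val ≠ N)
    (w : Fin (N + 1) → ℝ) :
    |w 0| + |w (Fin.last N)| ≤
      ∑ j : Fin (N + 1), (if ((0 : ℕ) : ℝ) < |(i.val : ℝ) - j.val| then |w j| else 0) := by
  have hnn : ∀ j ∈ (Finset.univ : Finset (Fin (N + 1))),
      0 ≤ (if ((0 : ℕ) : ℝ) < |(i.val : ℝ) - j.val| then |w j| else 0) := fun j _ => by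
    split_ifs
    · exact abs_nonneg _
    · exact le_rfl
  have h := Finset.add_le_sum hnn (Finset.mem_univ (0 : Fin (N + 1))) (Finset.mem_univ (Fin.last N))
    (zero_ne_last hN)
  have hi0' : (0 : ℝ) < (i.val : ℝ) := by exact_mod_cast Nat.pos_of_ne_zero hi0
  have hiN' : (i.val : ℝ) < N := by
    have := i.isLt
    exact_mod_cast (show i.val < N by omega)
  have c0 : ((0 : ℕ) : ℝ) < |(i.val : ℝ) - ((0 : Fin (N + 1)) : ℕ)| := by
    rw [Fin.val_zero, Nat.cast_zero, sub_zero]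
    exact abs_pos.2 hi0'.ne'
  have cN : ((0 : ℕ) : ℝ) < |(i.val : ℝ) - ((Fin.last N : Fin (N + 1)) : ℕ)| := by
    rw [Fin.val_last, Nat.cast_zero]
    exact abs_pos.2 (sub_ne_zero.2 hiN'.ne)
  rw [if_pos c0, if_pos cN] at h
  exact h

/-- **Bond-row bound** (registered sub-goal `ohm2_bond_row_abs_le` of crux `RobinCoercivity`, auxiliary to the link
theorem `orthogonalOhm_of_blockInputs`). For a bond row `i` (`i ≠ 0, N`): if `|Σ_j w_j u_j| ≤ C_F` (flux-row bound) and
the off-diagonal tail is `Σ_{j ≠ i} |w_j| ≤ τ₀`, then the bond-column sum satisfies `|Σ_{bond j} w_j| ≤ C_F + τ₀`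
(`Σ_{bond j} w_j = Σ_j w_j u_j − w_0 + w_N` by `ohm2_usplit`, and `|w_0| + |w_N| ≤ τ₀`). -/
theorem ohm2_bond_row_abs_le {N : ℕ} (hN : 1 ≤ N) (i : Fin (N + 1)) (hi0 : i.val ≠ 0) (hiN : i.val ≠ N)
    (w : Fin (N + 1) → ℝ) (CF τ0 : ℝ)
    (hF : |∑ j : Fin (N + 1), w j * (if j.val = N then -1 else 1)| ≤ CF)
    (hB : ∑ j : Fin (N + 1), (if ((0 : ℕ) : ℝ) < |(i.val : ℝ) - j.val| then |w j| else 0) ≤ τ0) :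
    |∑ j : Fin (N + 1), (if j.val ≠ 0 ∧ j.val ≠ N then w j else 0)| ≤ CF + τ0 := by
  have hu := ohm2_usplit hN w
  have h2 := ohm2_two_offdiag_le hN i hi0 hiN w
  have heq : (∑ j : Fin (N + 1), if j.val ≠ 0 ∧ j.val ≠ N then w j else 0) =
      (∑ j : Fin (N + 1), w j * (if j.val = N then -1 else 1)) - w 0 + w (Fin.last N) := by
    rw [hu]
    ring
  rw [heq]
  calc |(∑ j : Fin (N + 1), w j * (if j.val = N then -1 else 1)) - w 0 + w (Fin.last N)|
      ≤ |(∑ j : Fin (N + 1), w j * (if j.val = N then -1 else 1)) - w 0| + |w (Fin.last N)| := abs_add_le _ _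
    _ ≤ |∑ j : Fin (N + 1), w j * (if j.val = N then -1 else 1)| + |w 0| + |w (Fin.last N)| := by
        have := abs_sub (∑ j : Fin (N + 1), w j * (if j.val = N then -1 else 1)) (w 0)
        linarith
    _ ≤ CF + τ0 := by linarith

/-- **Contact-row bound.** For a contact row `i` (`i = 0` or `i = N`) every bond column is off-diagonal, so
`|Σ_{bond j} w_j| ≤ Σ_{j ≠ i} |w_j| ≤ τ₀`. -/
theorem ohm2_contact_row_abs_le {N : ℕ} (i : Fin (N + 1)) (hi : i.val = 0 ∨ i.val = N)
    (w : Fin (N + 1) → ℝ) (τ0 : ℝ)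
    (hB : ∑ j : Fin (N + 1), (if ((0 : ℕ) : ℝ) < |(i.val : ℝ) - j.val| then |w j| else 0) ≤ τ0) :
    |∑ j : Fin (N + 1), (if j.val ≠ 0 ∧ j.val ≠ N then w j else 0)| ≤ τ0 := by
  have hterm : ∀ j : Fin (N + 1), |(if j.val ≠ 0 ∧ j.val ≠ N then w j else 0)| ≤
      (if ((0 : ℕ) : ℝ) < |(i.val : ℝ) - j.val| then |w j| else 0) := by
    intro j
    by_cases hj : j.val ≠ 0 ∧ j.val ≠ N
    · have hne : (i.val : ℝ) ≠ j.val := by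
        have h' : i.val ≠ j.val := by omega
        exact_mod_cast h'
      rw [if_pos hj, if_pos (by rw [Nat.cast_zero]; exact abs_pos.2 (sub_ne_zero.2 hne))]
    · rw [if_neg hj, abs_zero]
      split_ifs
      · exact abs_nonneg _
      · exact le_rfl
  calc |∑ j : Fin (N + 1), (if j.val ≠ 0 ∧ j.val ≠ N then w j else 0)|
      ≤ ∑ j : Fin (N + 1), |(if j.val ≠ 0 ∧ j.val ≠ N then w j else 0)| := Finset.abs_sum_le_sum_abs _ _
    _ ≤ ∑ j : Fin (N + 1), (if ((0 : ℕ) : ℝ) < |(i.val : ℝ) - j.val| then |w j| else 0) :=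
        Finset.sum_le_sum fun j _ => hterm j
    _ ≤ τ0 := hB

/-! ### The contact rows of the block memory matrix at fixed `N` (abstract gadgets of the fixed-`N` package) -/

section FixedN

variable {ω₂ lam β γ : ℝ} {N : ℕ} {T : ℝ}
  {Adm : (PhaseSpace N → ℝ) → Prop}
  {corr : (PhaseSpace N → ℝ) → (PhaseSpace N → ℝ) → ℝ → ℝ}
  {lap : ℝ → (PhaseSpace N → ℝ) → (PhaseSpace N → ℝ) → ℝ}
  {cov : (PhaseSpace N → ℝ) → (PhaseSpace N → ℝ) → ℝ}
  {e : Fin N → PhaseSpace N → ℝ}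
  (hAdm : ∀ f, Adm f ↔ (Continuous f ∧ ∃ A : ℝ, ∀ z,
    |f z| ≤ A * Real.exp ((pinnedChain ω₂ lam β γ).hamiltonian N z / (8 * T))))
  (hcorr : ∀ f g t, corr f g t =
    (∫ z, f z * (∫ y, g y ∂((pinnedChain ω₂ lam β γ).transitionKernel N T T t.toNNReal z))
      ∂(pinnedChain ω₂ lam β γ).gibbsMeasure N T) -
    (∫ z, f z ∂(pinnedChain ω₂ lam β γ).gibbsMeasure N T) *
      (∫ z, g z ∂(pinnedChain ω₂ lam β γ).gibbsMeasure N T))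
  (hlap : ∀ s f g, lap s f g = ∫ t in Set.Ioi (0 : ℝ), Real.exp (-(s * t)) * corr f g t)
  (he : ∀ x z, e x z = z.2 x ^ 2 / 2 + (pinnedChain ω₂ lam β γ).U (z.1 x) +
    ∑ j : Fin N, ((if j.val = x.val + 1 then (pinnedChain ω₂ lam β γ).V (z.1 j - z.1 x) / 2 else 0) +
      (if x.val = j.val + 1 then (pinnedChain ω₂ lam β γ).V (z.1 x - z.1 j) / 2 else 0)))
  (hFI : ∀ f g : PhaseSpace N → ℝ, Adm f → Adm g →
    Integrable f ((pinnedChain ω₂ lam β γ).gibbsMeasure N T) ∧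
    (∀ t : ℝ, 0 ≤ t → Integrable (fun z => f z *
      (∫ y, g y ∂((pinnedChain ω₂ lam β γ).transitionKernel N T T t.toNNReal z)))
      ((pinnedChain ω₂ lam β γ).gibbsMeasure N T)) ∧
    IntegrableOn (corr f g) (Set.Ioi 0) ∧
    (∀ t : ℝ, 0 ≤ t → corr f g t = corr (fun z => g (z.1, -z.2)) (fun z => f (z.1, -z.2)) t) ∧
    (∀ s : ℝ, 0 < s → ∀ x : Fin N,
      s * lap s (e x) g - cov (e x) g =
        lap s (fun z => (pinnedChain ω₂ lam β γ).generator N T T (e x) (z.1, -z.2)) g ∧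
      s * lap s f (e x) - cov f (e x) = lap s f ((pinnedChain ω₂ lam β γ).generator N T T (e x))))
  (hω : 0 < ω₂) (hl : 0 ≤ lam) (hβ : 0 ≤ β) (hγ : 0 ≤ γ) (hT : 0 < T)
  (g : Fin (N + 1) → PhaseSpace N → ℝ)
  (hg : ∀ i z, g i z = (∑ b : Fin N, if b.val + 1 = i.val then (pinnedChain ω₂ lam β γ).bondCurrent N b z else 0) +
    (∑ x : Fin N, if (i.val = 0 ∧ x.val = 0) ∨ (i.val = N ∧ x.val + 1 = N) then
      (pinnedChain ω₂ lam β γ).γ * (T - z.2 x ^ 2) else 0))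

include hAdm hcorr hlap he hFI hω hl hβ hγ hT in
/-- **Affine rule in the first slot of the Schur pairing**: `schur_s(a·f + c, h) = a·schur_s(f, h)` for admissible
`f, h` and `s ≥ 0` (constants pair to zero with every admissible observable, `lap_const_left`). -/
theorem ohm2_schur_affine_left {s : ℝ} (hs : 0 ≤ s) (G : Matrix (Fin N) (Fin N) ℝ)
    (schur : (PhaseSpace N → ℝ) → (PhaseSpace N → ℝ) → ℝ)
    (hschur : ∀ f g, schur f g = lap s f g - ∑ u, ∑ v, lap s f (e u) * G⁻¹ u v * lap s (e v) g)
    (a c : ℝ) {f h : PhaseSpace N → ℝ} (hf : Adm f) (hh : Adm h) :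
    schur (fun z => a * f z + c) h = a * schur f h := by
  have hex : ∀ x, Adm (e x) := fun x => adm_e Adm hAdm e he hω hl hβ hT x
  have haf : Adm (fun z => a * f z) := adm_const_mul Adm hAdm a hf
  have hc : Adm (fun _ : PhaseSpace N => c) := adm_const Adm hAdm hω hl hβ hT c
  have key : ∀ k : PhaseSpace N → ℝ, Adm k → lap s (fun z => a * f z + c) k = a * lap s f k := by
    intro k hk
    rw [lap_add_left hcorr hlap hFI haf hc hk hs, lap_const_mul_left hcorr hlap,
      lap_const_left hAdm hcorr hlap hFI hω hl hβ hγ hT hk, add_zero]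
  have key' : ∀ u : Fin N, lap s (fun z => a * f z + c) (e u) = a * lap s f (e u) := fun u => key _ (hex u)
  rw [hschur, hschur, key h hh]
  simp only [key', Finset.mul_sum, mul_sub]
  congr 1
  exact Finset.sum_congr rfl fun u _ => Finset.sum_congr rfl fun v _ => by ring

include hg in
/-- **The reversed contact observable.** At a contact position `i` with its site `c` (`i = 0, c = 0` or
`i = N, c = N − 1`), `(g_i∘Θ)(z) = (−γ)·p_c² + γT`: the bond part of `g_i` is empty (`i = 0`) or the phantom
current `j_{N−1} ≡ 0` (`i = N`), and the contact part `γ(T − p_c²)` is even in `p`. -/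
theorem ohm2_contact_g_rev (hN : 1 ≤ N) (i : Fin (N + 1)) (c : Fin N)
    (hic : (i.val = 0 ∧ c.val = 0) ∨ (i.val = N ∧ c.val + 1 = N)) (z : PhaseSpace N) :
    g i (z.1, -z.2) = (-(pinnedChain ω₂ lam β γ).γ) * z.2 c ^ 2 + (pinnedChain ω₂ lam β γ).γ * T := by
  rw [blockForm_g_rev g hg i z]
  have h1 : (∑ b : Fin N, if b.val + 1 = i.val then (pinnedChain ω₂ lam β γ).bondCurrent N b z else 0) = 0 := by
    refine Finset.sum_eq_zero fun b _ => ?_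
    split_ifs with hb
    · exact bondCurrent_eq_zero_of_last _ b (by omega) z
    · rfl
  have h2 : (∑ x : Fin N, if (i.val = 0 ∧ x.val = 0) ∨ (i.val = N ∧ x.val + 1 = N) then
      (pinnedChain ω₂ lam β γ).γ * (T - z.2 x ^ 2) else 0) = (pinnedChain ω₂ lam β γ).γ * (T - z.2 c ^ 2) :=
    sum_ite_eq_of_unique (fun x => (pinnedChain ω₂ lam β γ).γ * (T - z.2 x ^ 2)) c hic
      (fun x hx => Fin.ext (by omega))
  rw [h1, h2, neg_zero, zero_add]
  ring

include hg in
/-- **The bond columns carry the total current**: `Σ_{j ≠ 0, N} g_j = Σ_c j_c = J` pointwise (the bond column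
`j = c + 1` carries `j_c`; the phantom current `j_{N−1}` of the column `j = N` vanishes anyway). -/
theorem ohm2_bondCols_g_sum (z : PhaseSpace N) :
    (∑ j : Fin (N + 1), if j.val ≠ 0 ∧ j.val ≠ N then g j z else 0) =
      ∑ c : Fin N, (pinnedChain ω₂ lam β γ).bondCurrent N c z := by
  rw [Fin.sum_univ_succ]
  have h0 : (if ((0 : Fin (N + 1)) : ℕ) ≠ 0 ∧ ((0 : Fin (N + 1)) : ℕ) ≠ N then g 0 z else 0) = 0 :=
    if_neg (by simp)
  rw [h0, zero_add]
  refine Finset.sum_congr rfl fun c _ => ?_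
  by_cases hc : c.val + 1 < N
  · rw [if_pos (by rw [Fin.val_succ]; omega)]
    exact bulk_g_eq g hg c.succ c (Fin.val_succ c).symm (by rw [Fin.val_succ]; omega) z
  · rw [if_neg (by rw [Fin.val_succ]; omega), bondCurrent_eq_zero_of_last _ c hc z]

include hAdm hcorr hlap he hFI hω hl hβ hγ hT hg in
/-- **Contact-row identity** (registered headline of this auxiliary file). At a contact position `i` with site
`c` (`i = 0, c = 0` or `i = N, c = N − 1`, `N ≥ 1`), for the block memory matrix
`W_{ij} = γT²[i = j contact] − schur_s(g_i∘Θ, g_j)`: every bond column is `W_{ij} = γ·schur_s(p_c², g_j)`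
(`ohm2_contact_g_rev` + `ohm2_schur_affine_left`), and the bond-column sum of the row is `γ·schur_s(p_c², J)`,
`J = Σ_c j_c` (second-slot linearity `sum_schur_right` + `ohm2_bondCols_g_sum`). -/
theorem ohm2_contact_row_sum_pkg (hN : 1 ≤ N) {s : ℝ} (hs : 0 ≤ s) (G : Matrix (Fin N) (Fin N) ℝ)
    (schur : (PhaseSpace N → ℝ) → (PhaseSpace N → ℝ) → ℝ)
    (hschur : ∀ f g, schur f g = lap s f g - ∑ u, ∑ v, lap s f (e u) * G⁻¹ u v * lap s (e v) g)
    (W : Fin (N + 1) → Fin (N + 1) → ℝ)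
    (hW : ∀ i j, W i j = (if i = j ∧ (i.val = 0 ∨ i.val = N) then (pinnedChain ω₂ lam β γ).γ * T ^ 2 else 0) -
      schur (fun z => g i (z.1, -z.2)) (g j))
    (i : Fin (N + 1)) (c : Fin N) (hic : (i.val = 0 ∧ c.val = 0) ∨ (i.val = N ∧ c.val + 1 = N)) :
    ∑ j : Fin (N + 1), (if j.val ≠ 0 ∧ j.val ≠ N then W i j else 0) =
      (pinnedChain ω₂ lam β γ).γ * schur (fun z => z.2 c ^ 2)
        (fun z => ∑ b : Fin N, (pinnedChain ω₂ lam β γ).bondCurrent N b z) := by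
  have hgi : (fun z : PhaseSpace N => g i (z.1, -z.2)) =
      fun z => (-(pinnedChain ω₂ lam β γ).γ) * z.2 c ^ 2 + (pinnedChain ω₂ lam β γ).γ * T :=
    funext fun z => ohm2_contact_g_rev g hg hN i c hic z
  have hadm_g : ∀ j, Adm (g j) := fun j => blockForm_adm_g hAdm hω hl hβ hT g hg j
  have hWj : ∀ j : Fin (N + 1), j.val ≠ 0 ∧ j.val ≠ N →
      W i j = (pinnedChain ω₂ lam β γ).γ * schur (fun z => z.2 c ^ 2) (g j) := by
    intro j hj
    have hne : ¬(i = j ∧ (i.val = 0 ∨ i.val = N)) := by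
      rintro ⟨h1, h2⟩
      have h3 := congrArg Fin.val h1
      omega
    rw [hW, if_neg hne, hgi, ohm2_schur_affine_left hAdm hcorr hlap he hFI hω hl hβ hγ hT hs G schur hschur _ _
      (adm_psq Adm hAdm hω hl hβ hT c) (hadm_g j)]
    ring
  rw [← Finset.sum_filter, Finset.sum_congr rfl fun j hj => hWj j (Finset.mem_filter.1 hj).2, ← Finset.mul_sum,
    sum_schur_right hAdm hcorr hlap he hFI hω hl hβ hT hs G schur hschur _ g (fun j _ => hadm_g j)
      (adm_psq Adm hAdm hω hl hβ hT c)]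
  congr 2
  funext z
  rw [Finset.sum_filter]
  exact ohm2_bondCols_g_sum g hg z

end FixedN

end Summit.AtomisticToContinuum.FouriersLaw.Theorems.HonestZwanzig.Robin

end
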